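import Summits.HodgeConjecture.HodgeConjecture.Theorems.Ring2AbelianAllAndreFibreClassDivisorialNodes
import HarnessLib

/-!
# Ring 2 · sub-cell AbelianAll (ALL ABELIAN VARIETIES), André axis, part XIV-g — complementary invariant parts
# have EQUAL DIMENSION and hard Lefschetz carries algebraic invariant classes from degree `2p` to `2(d−p)`:
# (β′_f) needs its typed hypotheses only in the LOWER HALF of the degrees; the W₆ row through the Lefschetz
# column with hypotheses (N₁), (N₂), (N₃) at one fibre

HONEST FRAMING (page 1, verbatim): **research route, not a corollary; conditional on HC_CM plus one named
minimal statement.** Cell line: research route conditional on HC_CM; not a corollary; Q11.4-sentence-2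
already refuted in dim ≥ 3. Nothing in this file proves a case of the Hodge conjecture for an abelian variety.
`HC_CM` = `Theses.RankFourFaces.CMAbelianHodge` (a BINDER), item `Theses.RankFourFaces.CMToAbelian` (stmt-16267)
OPEN and not closed here. Seat `pub-hodge-ring2-ab-andre-2`, gen 6 (RING2-MAP §AbelianAll AA2.41–AA2.48).

## What is proved (theorems only; no definition, no named fact, no sorry, no Hodge-conjecture input)

* §1 `finrank_range_eq_of_perfect` — linear algebra: a bilinear pairing `V₂ × V₁ → K` killing `ker j₂`, `ker j₁`
  and non-degenerate modulo them on both sides forces `dim j₁(V₁) = dim j₂(V₂)`.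
* §2 `finrank_range_map_fiberι_eq` — for a compact pencil of abelian `d`-folds and `p + q = d`:
  `dim j_{t₀}^* H²ᵖ(𝒳) = dim j_{t₀}^* H^{2q}(𝒳)` (the fibre-class pairing `τ((W ∪ [𝒳_{t₀}]) ∪ A)` is perfect modulo
  kernels: Poincaré duality on `𝒳(ℂ)` + the kernel identity (κ), as in part XIV-e).
* §3 `range_map_fiberι_eq_map_lefschetzPowTo` — `j_{t₀}^* H^{2(p+r)}(𝒳) = L_{K_{t₀}}ʳ (j_{t₀}^* H²ᵖ(𝒳))` for
  `2p + r = d` (⊇ by naturality; = by §2 and hard Lefschetz injectivity on the fibre);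
  **`algebraicInvariantClassesAt_of_lefschetz`: (N_p)(t₀) ⟹ (N_{p+r})(t₀)** (`Lᴷʳ` preserves algebraic classes);
  **`fibreClassLefschetzOn_of_algebraicInvariants_half`: (β′_f) ⟸ (N_p)(t₀) for all `2p ≤ d`**;
  `fibreClassLefschetzOn_of_divisorSpanned_of_le_three` (d ≤ 3 ⟸ (N₂) alone — parts XIV-c/d re-derived).
* §4 W₆ through the general rung: **`fibreClassLefschetzOn_relDim_six_of_algebraicInvariants`: (β′_f) for a
  compact pencil of abelian sixfolds ⟸ (N₁)(t₀) ∧ (N₂)(t₀) ∧ (N₃)(t₀)**; rows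
  **`weilSixfolds_of_cmPowerWeilPencilsAt_of_algebraicInvariants`**, `nonsplitSixfolds_…`: `WeilSixfolds ⟸ (W_E)₃ ∧
  [every CM-pointed compact pencil of abelian sixfolds has algebraic invariant classes in degrees 2, 4, 6 at some
  fibre]` — `HC_CM`-free. For the big-monodromy Weil pencils of the habitat, degrees 2 and 4 are `ℂθ`, `ℂθ²`
  (a monodromy statement) and degree 6 is `ℂθ³ ⊕ ℂω ⊕ ℂω̄` — the Weil classes: that is where the open content of the
  Lefschetz-type route to W₆ sits (RING2-MAP AA2.45), and nothing here proves it.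

References: Abdulali1994FamiliesAV (Conj. 5.3, Thm. 5.5 p. 1130); Andre1996Motifs (§6.3 Lemme 6.3.1, Remarque 2,
pp. 31–33); DeligneHodgeII1971 (4.1.1); VoisinHodgeI2002 (§6.2.3 Thm. 6.25); VoisinHodgeII2003 (Prop. 9.20);
HatcherAT2002 (§3.3 Prop. 3.38).
-/

noncomputable section

set_option linter.dupNamespace false

namespace Summit.HodgeConjecture.HodgeConjecture.Ring2.AbelianAll

open CategoryTheory AlgebraicGeometry MonoidalCategory CartesianMonoidalCategory
open Literature.AlgebraicGeometry Literature.AlgebraicGeometry.Motives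
open Literature.AlgebraicGeometry.HodgeTheory
open Literature.AlgebraicTopology.SingularHomology (singularCohomology cupProduct cupProduct_one'
  cupProduct_assoc cupProduct_gradedComm_holds singularCohomologyZeroEquiv cupPairing
  isPerfPair_cupPairing_of_field_holds)
open Literature.Geometry.Kaehler (HasHardLefschetzProperty)
open Literature.AlgebraicGeometry.Deligne1982 (cmLocus)

variable {𝒳 S : SchemeOver ℂ}

/-! ## §1 Linear algebra: a pairing perfect modulo two kernels forces equal ranks -/

/-- **Equal ranks from a pairing perfect modulo kernels.** For linear `j₁ : V₁ → U₁`, `j₂ : V₂ → U₂` (`V₁`, `V₂`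
finite-dimensional) and a bilinear `B : V₂ × V₁ → K` killing `ker j₂` on the left and `ker j₁` on the right and
non-degenerate modulo these kernels on both sides, `dim j₁(V₁) = dim j₂(V₂)` (the induced pairing
`V₂/ker j₂ × V₁/ker j₁ → K` embeds each quotient into the dual of the other). [folklore] -/
theorem finrank_range_eq_of_perfect {K V₁ V₂ U₁ U₂ : Type*} [Field K]
    [AddCommGroup V₁] [Module K V₁] [FiniteDimensional K V₁] [AddCommGroup V₂] [Module K V₂]
    [FiniteDimensional K V₂] [AddCommGroup U₁] [Module K U₁] [AddCommGroup U₂] [Module K U₂]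
    (j₁ : V₁ →ₗ[K] U₁) (j₂ : V₂ →ₗ[K] U₂) (B : V₂ →ₗ[K] V₁ →ₗ[K] K)
    (hB₁ : ∀ a, j₂ a = 0 → ∀ w, B a w = 0) (hB₂ : ∀ w, j₁ w = 0 → ∀ a, B a w = 0)
    (hB₃ : ∀ a, (∀ w, B a w = 0) → j₂ a = 0) (hB₄ : ∀ w, (∀ a, B a w = 0) → j₁ w = 0) :
    Module.finrank K (LinearMap.range j₁) = Module.finrank K (LinearMap.range j₂) := by
  classical
  set P₁ : Submodule K V₁ := LinearMap.ker j₁ with hP₁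
  set P₂ : Submodule K V₂ := LinearMap.ker j₂ with hP₂
  have hk₁ : P₂ ≤ LinearMap.ker B := fun a ha ↦ by
    rw [LinearMap.mem_ker]
    ext w
    exact hB₁ a (LinearMap.mem_ker.1 ha) w
  set B₁ : (V₂ ⧸ P₂) →ₗ[K] V₁ →ₗ[K] K := P₂.liftQ B hk₁ with hB₁def
  have hB₁_mk : ∀ a w, B₁ (Submodule.Quotient.mk a) w = B a w := fun a w ↦ rfl
  have hk₂ : P₁ ≤ LinearMap.ker B₁.flip := fun w hw ↦ by
    rw [LinearMap.mem_ker]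
    refine LinearMap.ext fun q ↦ ?_
    obtain ⟨a, rfl⟩ := Submodule.mkQ_surjective P₂ q
    change B₁ (Submodule.Quotient.mk a) w = 0
    rw [hB₁_mk]
    exact hB₂ w (LinearMap.mem_ker.1 hw) a
  set Bq : (V₂ ⧸ P₂) →ₗ[K] (V₁ ⧸ P₁) →ₗ[K] K := (P₁.liftQ B₁.flip hk₂).flip with hBqdef
  have hBq_mk : ∀ a w, Bq (Submodule.Quotient.mk a) (Submodule.Quotient.mk w) = B a w := fun a w ↦ rfl
  have hinj : Function.Injective Bq := by
    rw [← LinearMap.ker_eq_bot, Submodule.eq_bot_iff]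
    intro q hq
    obtain ⟨a, rfl⟩ := Submodule.mkQ_surjective P₂ q
    change Submodule.Quotient.mk a = (0 : V₂ ⧸ P₂)
    rw [Submodule.Quotient.mk_eq_zero]
    refine LinearMap.mem_ker.2 (hB₃ a fun w ↦ ?_)
    rw [← hBq_mk]
    exact LinearMap.congr_fun (LinearMap.mem_ker.1 hq) (Submodule.Quotient.mk w)
  have hinj' : Function.Injective Bq.flip := by
    rw [← LinearMap.ker_eq_bot, Submodule.eq_bot_iff]
    intro q hq
    obtain ⟨w, rfl⟩ := Submodule.mkQ_surjective P₁ q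
    change Submodule.Quotient.mk w = (0 : V₁ ⧸ P₁)
    rw [Submodule.Quotient.mk_eq_zero]
    refine LinearMap.mem_ker.2 (hB₄ w fun a ↦ ?_)
    rw [← hBq_mk]
    exact LinearMap.congr_fun (LinearMap.mem_ker.1 hq) (Submodule.Quotient.mk a)
  have hle₂ : Module.finrank K (V₂ ⧸ P₂) ≤ Module.finrank K (V₁ ⧸ P₁) := by
    have h := LinearMap.finrank_le_finrank_of_injective hinj
    rwa [Subspace.dual_finrank_eq] at h
  have hle₁ : Module.finrank K (V₁ ⧸ P₁) ≤ Module.finrank K (V₂ ⧸ P₂) := by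
    have h := LinearMap.finrank_le_finrank_of_injective hinj'
    rwa [Subspace.dual_finrank_eq] at h
  rw [← (LinearMap.quotKerEquivRange j₁).finrank_eq, ← (LinearMap.quotKerEquivRange j₂).finrank_eq]
  exact le_antisymm hle₁ hle₂

/-! ## §2 `dim j_{t₀}^* H²ᵖ(𝒳) = dim j_{t₀}^* H^{2(d-p)}(𝒳)`: the fibre-class pairing is perfect modulo kernels -/

/-- **Complementary invariant parts have the same dimension**: for a compact pencil of abelian `d`-folds and
`p + q = d`, `dim j_{t₀}^* H²ᵖ(𝒳(ℂ); ℂ) = dim j_{t₀}^* H^{2q}(𝒳(ℂ); ℂ)` — the pairing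
`(A, W) ↦ τ((W ∪ [𝒳_{t₀}]) ∪ A)` on `H^{2q} × H²ᵖ` is perfect modulo `ker j_{t₀}^*` on both sides (Poincaré duality
on `𝒳(ℂ)` and the kernel identity (κ) in degrees `p`, `q`, exactly as in part XIV-e), §1. (In print: Poincaré
duality on the fibre restricted to the invariants, Deligne.) [cite: DeligneHodgeII1971, Thm. 4.1.1]
[cite: HatcherAT2002, §3.3 Prop. 3.38] -/
theorem finrank_range_map_fiberι_eq {d : ℕ} {f : 𝒳 ⟶ S} (hf : IsCompactAbelianPencil f d) {p q : ℕ}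
    (hpq : p + q = d) (t₀ : ComplexPoints S) :
    Module.finrank ℂ (LinearMap.range (complexBetti.map (fiberι f t₀) (2 * p)).hom) =
      Module.finrank ℂ (LinearMap.range (complexBetti.map (fiberι f t₀) (2 * q)).hom) := by
  have h𝒳 := hf.isSmoothProjective_total
  haveI : Module.Finite ℂ (complexBetti 𝒳 (2 * p)) := finite_complexBetti h𝒳 _
  haveI : Module.Finite ℂ (complexBetti 𝒳 (2 * q)) := finite_complexBetti h𝒳 _
  obtain ⟨τ, hτ0, -⟩ := exists_crossTrace h𝒳 h𝒳
  set j₁ : complexBetti 𝒳 (2 * p) →ₗ[ℂ] complexBetti (fiberOver f t₀) (2 * p) :=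
    (complexBetti.map (fiberι f t₀) (2 * p)).hom with hj₁
  have hj₁apply : ∀ W, j₁ W = complexBetti.map (fiberι f t₀) (2 * p) W := fun _ ↦ rfl
  set j₂ : complexBetti 𝒳 (2 * q) →ₗ[ℂ] complexBetti (fiberOver f t₀) (2 * q) :=
    (complexBetti.map (fiberι f t₀) (2 * q)).hom with hj₂
  have hj₂apply : ∀ A, j₂ A = complexBetti.map (fiberι f t₀) (2 * q) A := fun _ ↦ rfl
  set L : complexBetti 𝒳 (2 * p) →ₗ[ℂ] complexBetti 𝒳 (2 * (p + 1)) := fiberGysin hf t₀ p ∘ₗ j₁ with hL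
  have hLapply : ∀ W, L W = fiberGysin hf t₀ p (complexBetti.map (fiberι f t₀) (2 * p) W) := fun _ ↦ rfl
  have hak : 2 * (p + 1) + 2 * q = 2 * (d + 1) := by omega
  set B : complexBetti 𝒳 (2 * q) →ₗ[ℂ] complexBetti 𝒳 (2 * p) →ₗ[ℂ] ℂ :=
    (((cupProduct hak).compl₁₂ L LinearMap.id).compr₂ τ).flip with hB
  have hBapply : ∀ A W, B A W = τ (cupProduct hak (L W) A) := fun _ _ ↦ rfl
  set F := fiberGysin hf t₀ 0 (singularCohomology.one ℂ (ComplexPoints (fiberOver f t₀))) with hF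
  have h1F : 2 * p + 2 * (0 + 1) = 2 * (p + 1) := by ring
  have hLW : ∀ W : complexBetti 𝒳 (2 * p), L W = cupProduct h1F W F := fun W ↦
    fiberGysin_map_fiberι_eq_cupProduct hf t₀ W
  letI := h𝒳.chartedSpace
  haveI := ComplexPoints.compactSpace_of_isSmoothProjective h𝒳
  haveI := ComplexPoints.t2Space_of_isSmoothProjective h𝒳
  have hB₂ : ∀ W, j₁ W = 0 → ∀ A, B A W = 0 := fun W hW A ↦ by
    rw [hBapply, hLapply, ← hj₁apply, hW, map_zero, map_zero, LinearMap.zero_apply, map_zero]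
  have hB₁ : ∀ A, j₂ A = 0 → ∀ W, B A W = 0 := fun A hA W ↦ by
    rw [hBapply]
    have hcomm := cupProduct_gradedComm_holds ℂ _ hak (show 2 * q + 2 * (p + 1) = 2 * (d + 1) by omega) (L W) A
    rw [hcomm, hLapply]
    have hproj := complexGysin_cup (μ := complexOrientationFamily) hasPoincareDuality_complexOrientationFamily
      (hf.isSmoothProjective_fiberOver t₀) h𝒳 (fiberι f t₀)
      (show 2 * q + 2 * p = 2 * d by omega)
      (show 2 * d + 2 * (d + 1) = 2 * (d + 1) + 2 * d by ring)
      (show 2 * p + 2 * (d + 1) = 2 * (p + 1) + 2 * d by ring)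
      (show 2 * q + 2 * (p + 1) = 2 * (d + 1) by omega) A
      (complexBetti.map (fiberι f t₀) (2 * p) W)
    have hfg : fiberGysin hf t₀ p (complexBetti.map (fiberι f t₀) (2 * p) W) =
        complexGysin complexOrientationFamily (hf.isSmoothProjective_fiberOver t₀) h𝒳 (fiberι f t₀)
          (show 2 * p + 2 * (d + 1) = 2 * (p + 1) + 2 * d by ring)
          (complexBetti.map (fiberι f t₀) (2 * p) W) := rfl
    rw [hfg, ← hproj, ← hj₂apply A, hA, map_zero, LinearMap.zero_apply, map_zero, smul_zero, map_zero]
  have hB₃ : ∀ A, (∀ W, B A W = 0) → j₂ A = 0 := fun A hA ↦ by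
    have h1 : ∀ W : complexBetti 𝒳 (2 * p), cupProduct hak (L W) A = 0 := fun W ↦
      hτ0 _ (by rw [← hBapply]; exact hA W)
    have hFA : 2 * (0 + 1) + 2 * q = 2 * (q + 1) := by ring
    have hdeg : 2 * p + 2 * (q + 1) = 2 * (d + 1) := by omega
    set y := cupProduct hFA F A with hy
    have h2 : ∀ W : complexBetti 𝒳 (2 * p), cupProduct hdeg W y = 0 := fun W ↦ by
      rw [hy, ← cupProduct_assoc h1F hFA hak hdeg, ← hLW W]
      exact h1 W
    have hy0 : y = 0 := by
      have hPerf : (cupPairing (complexOrientationFamily h𝒳) hdeg).IsPerfPair :=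
        isPerfPair_cupPairing_of_field_holds
      refine (LinearMap.IsPerfPair.bijective_right (cupPairing (complexOrientationFamily h𝒳) hdeg)).1 ?_
      rw [map_zero]
      ext W
      rw [LinearMap.flip_apply, LinearMap.zero_apply,
        Literature.AlgebraicTopology.SingularHomology.cupPairing_apply, h2 W, map_zero, LinearMap.zero_apply]
    have h3 : fiberGysin hf t₀ q (complexBetti.map (fiberι f t₀) (2 * q) A) = 0 := by
      rw [fiberGysin_map_fiberι_eq_cupProduct hf t₀ A]
      have hcomm := cupProduct_gradedComm_holds ℂ _ hFA (show 2 * q + 2 * (0 + 1) = 2 * (q + 1) by ring) F A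
      rw [← hy, hy0, eq_comm, smul_eq_zero] at hcomm
      rcases hcomm with h | h
      · exact absurd h (by simp)
      · exact h
    rw [hj₂apply]
    exact fibreGysinKernelOn_holds hf q t₀ t₀ A h3
  have hB₄ : ∀ W, (∀ A, B A W = 0) → j₁ W = 0 := fun W hW ↦ by
    have h1 : ∀ A : complexBetti 𝒳 (2 * q), cupProduct hak (L W) A = 0 := fun A ↦
      hτ0 _ (by rw [← hBapply]; exact hW A)
    have hL0 : L W = 0 := by
      have hPerf : (cupPairing (complexOrientationFamily h𝒳) hak).IsPerfPair :=
        isPerfPair_cupPairing_of_field_holds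
      refine (LinearMap.IsPerfPair.bijective_left (cupPairing (complexOrientationFamily h𝒳) hak)).1 ?_
      rw [map_zero]
      ext A
      rw [LinearMap.zero_apply, Literature.AlgebraicTopology.SingularHomology.cupPairing_apply, h1 A, map_zero,
        LinearMap.zero_apply]
    rw [hj₁apply]
    exact fibreGysinKernelOn_holds hf p t₀ t₀ W (by rw [← hLapply]; exact hL0)
  exact finrank_range_eq_of_perfect j₁ j₂ B hB₁ hB₂ hB₃ hB₄

/-! ## §3 Hard Lefschetz moves algebraic invariant classes up: (N_p) ⟹ (N_{d-p}) for `2p ≤ d` -/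

/-- **`j_{t₀}^* H^{2(p+r)}(𝒳) = L_{K_{t₀}}ʳ (j_{t₀}^* H²ᵖ(𝒳))` for `2p + r = d`** (`K` the algebraic Lefschetz class of
part XIV-b): `⊇` since `j^*` intertwines `Lᴷ` and `L_{K_t}`; equality by dimensions — §2 and the injectivity of
`L_{K_t}ʳ : H²ᵖ(𝒳_{t₀}) ⥲ H^{2(p+r)}(𝒳_{t₀})` (hard Lefschetz on the fibre). [cite: VoisinHodgeI2002, §6.2.3 Thm. 6.25]
[cite: DeligneHodgeII1971, Thm. 4.1.1] -/
theorem range_map_fiberι_eq_map_lefschetzPowTo {d : ℕ} {f : 𝒳 ⟶ S} (hf : IsCompactAbelianPencil f d)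
    {K : complexBetti 𝒳 2} (hKL : ∀ s : ComplexPoints S, HasHardLefschetzProperty (complexBetti.map (fiberι f s) 2 K) d)
    {p r : ℕ} (hpr : 2 * p + r = d) (hm : 2 * p + 2 * r = 2 * (p + r)) (t₀ : ComplexPoints S) :
    LinearMap.range (complexBetti.map (fiberι f t₀) (2 * (p + r))).hom =
      (LinearMap.range (complexBetti.map (fiberι f t₀) (2 * p)).hom).map
        (lefschetzPowTo (complexBetti.map (fiberι f t₀) 2 K) r (2 * p) (2 * (p + r)) hm) := by
  haveI : Module.Finite ℂ (complexBetti (fiberOver f t₀) (2 * (p + r))) :=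
    finite_complexBetti (hf.isSmoothProjective_fiberOver t₀) _
  haveI : Module.Finite ℂ (complexBetti 𝒳 (2 * p)) := finite_complexBetti hf.isSmoothProjective_total _
  set Lt := lefschetzPowTo (complexBetti.map (fiberι f t₀) 2 K) r (2 * p) (2 * (p + r)) hm with hLt
  have hinj : Function.Injective Lt :=
    (bijective_lefschetzPowTo_of_hasHardLefschetz _ (hKL t₀) (show 2 * p + r = d from hpr) _ hm).1
  -- `⊇`
  have hle : (LinearMap.range (complexBetti.map (fiberι f t₀) (2 * p)).hom).map Lt ≤
      LinearMap.range (complexBetti.map (fiberι f t₀) (2 * (p + r))).hom := by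
    rintro _ ⟨u, ⟨W, rfl⟩, rfl⟩
    refine ⟨lefschetzPowTo K r (2 * p) (2 * (p + r)) hm W, ?_⟩
    change complexBetti.map (fiberι f t₀) (2 * (p + r)) (lefschetzPowTo K r (2 * p) (2 * (p + r)) hm W) =
      Lt (complexBetti.map (fiberι f t₀) (2 * p) W)
    rw [hLt, map_fiberι_lefschetzPowTo]
  -- dimensions
  refine (Submodule.eq_of_le_of_finrank_eq hle ?_).symm
  rw [(Submodule.equivMapOfInjective Lt hinj _).symm.finrank_eq]
  exact finrank_range_map_fiberι_eq hf (p := p) (q := p + r) (by omega) t₀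

/-- **(N_p)(t₀) ⟹ (N_{p+r})(t₀) for `2p + r = d`**: algebraic invariant classes in degree `2p ≤ d` give algebraic
invariant classes in the complementary degree `2(d - p)`, by `Lᴷʳ` (which preserves algebraic classes, `K` a
divisor class) and `j^* H^{2(p+r)} = L_{K_t}ʳ j^* H²ᵖ`. So parts XIV-b…e need their hypotheses only in degrees
`2p ≤ d`. [cite: VoisinHodgeI2002, §6.2.3 Thm. 6.25] [cite: VoisinHodgeII2003, §9.2.4 Prop. 9.20] -/
theorem algebraicInvariantClassesAt_of_lefschetz {d : ℕ} {f : 𝒳 ⟶ S} (hf : IsCompactAbelianPencil f d)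
    {t₀ : ComplexPoints S} {p r : ℕ} (hpr : 2 * p + r = d) (h : AlgebraicInvariantClassesAt hf t₀ p) :
    AlgebraicInvariantClassesAt hf t₀ (p + r) := fun A ↦ by
  have h𝒳 := hf.isSmoothProjective_total
  obtain ⟨K, hKalg, hKL⟩ := exists_algebraic_lefschetzClass hf
  have hm : 2 * p + 2 * r = 2 * (p + r) := by ring
  have hmem : complexBetti.map (fiberι f t₀) (2 * (p + r)) A ∈
      (LinearMap.range (complexBetti.map (fiberι f t₀) (2 * p)).hom).map
        (lefschetzPowTo (complexBetti.map (fiberι f t₀) 2 K) r (2 * p) (2 * (p + r)) hm) := by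
    rw [← range_map_fiberι_eq_map_lefschetzPowTo hf hKL hpr hm t₀]
    exact ⟨A, rfl⟩
  obtain ⟨u, ⟨W, rfl⟩, hu⟩ := hmem
  obtain ⟨D, hD, hDW⟩ := h W
  refine ⟨lefschetzPowTo K r (2 * p) (2 * (p + r)) hm D,
    lefschetzPowTo_mem_supportedClasses_of_mem h𝒳 hKalg p hD r (2 * (p + r)) hm, ?_⟩
  rw [map_fiberι_lefschetzPowTo, hDW]
  exact hu

/-- **(β′_f) ⟸ algebraic invariant classes in the LOWER HALF of the degrees**: if (N_p)(t₀) holds for every `p` with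
`2p ≤ d`, then `FibreClassLefschetzOn hf` (part XIV-e's `fibreClassLefschetzOn_of_algebraicInvariants` with the
upper half supplied by `algebraicInvariantClassesAt_of_lefschetz`). [cite: Abdulali1994FamiliesAV, Conjecture 5.3 (p. 1130)] -/
theorem fibreClassLefschetzOn_of_algebraicInvariants_half {d : ℕ} {f : 𝒳 ⟶ S} (hf : IsCompactAbelianPencil f d)
    (t₀ : ComplexPoints S) (hN : ∀ p, 2 * p ≤ d → AlgebraicInvariantClassesAt hf t₀ p) :
    FibreClassLefschetzOn hf := by
  refine fibreClassLefschetzOn_of_algebraicInvariants hf t₀ fun p hp ↦ ?_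
  by_cases h2 : 2 * p ≤ d
  · exact hN p h2
  · obtain ⟨r, hr⟩ : ∃ r, d - p + r = p := ⟨p - (d - p), by omega⟩
    have h := algebraicInvariantClassesAt_of_lefschetz hf (p := d - p) (r := r) (by omega) (hN (d - p) (by omega))
    rwa [hr] at h

/-- The `d = 2`, `d = 3` theorems of parts XIV-c/d re-derived from the general rung: (N₀) is automatic and
(N₁) = divisoriality is the only input in the lower half. [cite: Abdulali1994FamiliesAV, Conjecture 5.3 (p. 1130)] -/
theorem fibreClassLefschetzOn_of_divisorSpanned_of_le_three {d : ℕ} {f : 𝒳 ⟶ S} (hf : IsCompactAbelianPencil f d)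
    (hd : d ≤ 3) (t₀ : ComplexPoints S) (h : DivisorSpannedInvariantHTwoAt hf t₀) : FibreClassLefschetzOn hf :=
  fibreClassLefschetzOn_of_algebraicInvariants_half hf t₀ fun p hp ↦ by
    rcases p with _ | _ | p
    · exact algebraicInvariantClassesAt_zero hf t₀
    · exact h
    · omega

/-! ## §4 The W₆ habitat through the general rung: everything except degree `3` is divisorial -/

/-- **(β′_f) for a compact pencil of abelian SIXFOLDS ⟸ (N₁)(t₀) ∧ (N₂)(t₀) ∧ (N₃)(t₀)** (degrees `0`: automatic;
`4, 5, 6`: from `2, 1, 0` by hard Lefschetz, §3). For the big-monodromy Weil pencils of the habitat (W_E)₃ the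
invariant parts in degrees `2` and `4` are `ℂθ`, `ℂθ²` (so (N₁), (N₂) reduce to a monodromy statement) and (N₃)
— the `SU(3,3)`-invariant part `ℂθ³ ⊕ ℂω ⊕ ℂω̄` of `H⁶` — CONTAINS THE WEIL CLASSES: the open content of the
Lefschetz-type route to W₆ sits exactly there (RING2-MAP AA2.45). [cite: Abdulali1994FamiliesAV, Conjecture 5.3 (p. 1130)]
[cite: Andre1996Motifs, §6.3 Remarque 2 (p. 33)] -/
theorem fibreClassLefschetzOn_relDim_six_of_algebraicInvariants {f : 𝒳 ⟶ S} (hf : IsCompactAbelianPencil f 6)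
    (t₀ : ComplexPoints S) (h₁ : AlgebraicInvariantClassesAt hf t₀ 1) (h₂ : AlgebraicInvariantClassesAt hf t₀ 2)
    (h₃ : AlgebraicInvariantClassesAt hf t₀ 3) : FibreClassLefschetzOn hf :=
  fibreClassLefschetzOn_of_algebraicInvariants_half hf t₀ fun p hp ↦ by
    obtain rfl | rfl | rfl | rfl : p = 0 ∨ p = 1 ∨ p = 2 ∨ p = 3 := by omega
    · exact algebraicInvariantClassesAt_zero hf t₀
    · exact h₁
    · exact h₂
    · exact h₃

/-- **W₆ row through the Lefschetz column, hypotheses AS SMALL AS THIS COLUMN CAN MAKE THEM**: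
`WeilSixfolds ⟸ (W_E)₃ ∧ [every CM-pointed compact pencil of abelian sixfolds has, at some fibre, algebraic
invariant classes in degrees 2, 4, 6]` — `HC_CM`-free (part IX's row fed with §4). The bracket is where the Weil
classes hide (degree 6); nothing here proves it. [cite: Andre1996Motifs, §6.3 Lemme 6.3.1 and Remarque 2 (pp. 31–33)]
[cite: Abdulali1994FamiliesAV, Conjecture 5.3 (p. 1130)] -/
theorem weilSixfolds_of_cmPowerWeilPencilsAt_of_algebraicInvariants (hW : CMPowerAnchoredCompactWeilPencilsAt 3)
    (hN : ∀ ⦃𝒳 S : SchemeOver ℂ⦄ ⦃f : 𝒳 ⟶ S⦄ (hf : IsCompactAbelianPencil f 6), (cmLocus f 6).Nonempty →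
      ∃ t₀ : ComplexPoints S, AlgebraicInvariantClassesAt hf t₀ 1 ∧ AlgebraicInvariantClassesAt hf t₀ 2 ∧
        AlgebraicInvariantClassesAt hf t₀ 3) :
    Theses.SevenfoldWeilCensus.WeilSixfolds :=
  weilSixfolds_of_cmPowerWeilPencilsAt_of_fibreClassLefschetzOnAtRelDim_six hW fun _ _ _ hf hcm ↦ by
    obtain ⟨t₀, h₁, h₂, h₃⟩ := hN hf hcm
    exact fibreClassLefschetzOn_relDim_six_of_algebraicInvariants hf t₀ h₁ h₂ h₃

/-- The same for `NonsplitSixfolds`. [cite: Andre1996Motifs, §6.3 Remarque 2 (p. 33)] -/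
theorem nonsplitSixfolds_of_cmPowerWeilPencilsAt_of_algebraicInvariants (hW : CMPowerAnchoredCompactWeilPencilsAt 3)
    (hN : ∀ ⦃𝒳 S : SchemeOver ℂ⦄ ⦃f : 𝒳 ⟶ S⦄ (hf : IsCompactAbelianPencil f 6), (cmLocus f 6).Nonempty →
      ∃ t₀ : ComplexPoints S, AlgebraicInvariantClassesAt hf t₀ 1 ∧ AlgebraicInvariantClassesAt hf t₀ 2 ∧
        AlgebraicInvariantClassesAt hf t₀ 3) :
    WeilTypeLadder.NonsplitSixfolds :=
  nonsplitSixfolds_of_cmPowerWeilPencilsAt_of_fibreClassLefschetzOnAtRelDim_six hW fun _ _ _ hf hcm ↦ by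
    obtain ⟨t₀, h₁, h₂, h₃⟩ := hN hf hcm
    exact fibreClassLefschetzOn_relDim_six_of_algebraicInvariants hf t₀ h₁ h₂ h₃

end Summit.HodgeConjecture.HodgeConjecture.Ring2.AbelianAll

end
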